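import Literature.AnabelianGeometry.EtaleTheta.Discharge.Sec1Thm110ModelChiNV
import Literature.AnabelianGeometry.EtaleTheta.Discharge.Sec1Thm110MatchingOfDeck
import HarnessLib

/-!
# [EtTh] Def. 1.9 at the χ-twisted model: the DECK TRANSFORMATION `τ ↦ τ⁻¹` EXISTS at `modelχ`, and Thm. 1.10 (i)(ii)
# follow there by the K2 deck route with every binder discharged

S. Mochizuki, *The étale theta function and its Frobenioid-theoretic manifestations*, Publ. RIMS **45** (2009) [EtTh],
§1, Def. 1.9 p. 29 (PRIMS p. 255: "`√−1` determines a 4-torsion point `τ` … the 4-torsion point `τ⁻¹` determined by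
`−√−1` admits a similar description"), Thm. 1.10 (i)(ii) pp. 29–30 [cite: MochizukiEtTh2009, Def 1.9 p.29]. Layer L2
of the abc-iut cell, seat abc-iut-w5-d140 (gen 4; K2 holder lineage, row «K2-NV@modelχ», third file). PROOF-ONLY over
this lineage's `Discharge/Sec1Thm110ModelChiNV` (`tauχ`, `tauInvχ`, `anchoredStandardDataχ`, `modelχ_thm110i_inputs`)
and `Discharge/Sec1Thm110MatchingOfDeck` (p430193: `thm110i/ii_of_decompTransport_of_deck`), abc-iut-L2-t6's
`anchoredPointχ` / `sectionOfUnitχ` / `kappaUnitχ` (`SettingModelChiAnchoredPoints`), abc-iut-L2-t5's `kummerZH` calculus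
(`kummerZH_mulRoots`, `kummerZH_cast`, `kummerZH_eq_mul_coboundary`, `cycEquiv`; `SettingModelKummerCocycleP/Q`),
abc-iut-w5-d024/L2-t1's `bPowGfp` / `twistGfp_bPowGfp` (`SettingModelCuspAxis`) and the tree's `RootSystem` (`mul`,
`cast`, `one`, `divCyclotome`; `Cyclotome.lean`) — all consumed BY NAME, nothing restated.

THE POINT. The K2 deck theorems (p430193 / p425484) take the DECK RELATION `D_{τ⁻¹} = ε⁻¹ · D_τ · ε` with
`toZ ε = 1` as DATA (`hDα`, `hDβ`: «`τ⁻¹` is the image of `τ` under the `μ₂`-deck transformation of `Ÿ → Y`»). At the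
χ-model `D_τ = s_{√−1}(G_{ℚ_p})`, `D_{τ⁻¹} = s_{(√−1)⁻¹}(G_{ℚ_p})` for the `κ_u²`-twisted sections
`s_u : σ ↦ ⟨b^{2κ_u(σ)}, σ⟩`, and conjugating `s_{u'}` by `b^t` gives `σ ↦ ⟨b^{t + 2κ_{u'}(σ) − χ(σ)t}, σ⟩`. So a deck
element `ε := b^t` of degree `0` exists iff `2κ_{√−1} − 2κ_{(√−1)⁻¹}` is a `χ`-COBOUNDARY `σ ↦ (1 − χ(σ))·t` — and it
IS: `κ_u + κ_{u⁻¹}` is the Kummer cocycle of a root system of `u·u⁻¹ = 1`, hence the coboundary of a compatible system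
of roots of unity (`exists_coboundary_of_eq_one`), and `4κ_{(√−1)⁻¹}` is the Kummer cocycle of a root system of
`((√−1)⁻¹)⁴ = 1`, hence a coboundary too; `2κ_u − 2κ_{u'} = 2(κ_u + κ_{u'}) − 4κ_{u'}` (`deck_algebra`). RESULTS:
* **`exists_deck_modelχ (hp) : ∃ ε : Π^tp_X, toZ ε = 1 ∧ (∀ σ, ε · s_{(√−1)⁻¹}(σ) · ε⁻¹ = s_{√−1}(σ)) ∧
  D_{τ⁻¹} = D_τ.comap (conj ε)`** — the deck binder of the K2 theorems is INHABITED at `MuTwoSetting.modelχ`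
  (`exists_deck_anchoredStandardDataχ`); by this lineage's `deck_not_mem_GtpYdd` the element is then NOT in `Π^tp_Ÿ`
  (`exists_deck_not_mem_GtpYdd_modelχ`: a genuine `Gal(Ÿ/Y)`-representative, consistent with print's `μ₂`-deck
  transformation);
* **`modelχ_thm110i_and_ii_of_deck`**: at `γ = id` the deck route p430193 concludes `Thm110i H A A ∧ Thm110ii H A A`
  with ALL its binders discharged at the model — `Thm110DeltaInduced`/`Thm110DeltaCompat` (δ = id), the typed row r5
  `Thm110DecompTransport` (conjugator `1`), `Prop15ii` (abc-iut-L6-d5), and the two deck relations (this file).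

HONEST FRAMING: SEMI-SYNTHETIC model (the χ-twisted root; not the tempered `π₁` of a curve) — non-vacuity /
consistency evidence for the typed interface ONLY; `γ = id`; nothing of [EtTh] is asserted; typed ≠ proved; no side
is taken on [IUTchIII] Cor. 3.12. PROOF-ONLY: no definition, no instance, no `Prop` fact.
-/

noncomputable section

namespace Literature.AnabelianGeometry.EtaleTheta.SettingModel

open Literature.AnabelianGeometry.SemiGraphs Literature.AnabelianGeometry.AbsoluteAnabelian
open _root_.Topology _root_.Function

variable (p : ℕ) [Fact p.Prime]

/-! ### §1. The abelian-group bookkeeping behind the deck element -/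

/-- In a commutative group with an endomorphism `χ`: from `k·k' = χ(c₀)/c₀` and `k'⁴ = χ(c₁)/c₁`, the element
`t := c₁/c₀²` satisfies `t · k'² / χ(t) = k²`. [folklore] -/
private theorem deck_algebra {G : Type*} [CommGroup G] (χ : G →* G) {k k' c₀ c₁ : G}
    (hA : k * k' = χ c₀ * c₀⁻¹) (hB : k' * k' * (k' * k') = χ c₁ * c₁⁻¹) :
    c₁ * c₀⁻¹ * c₀⁻¹ * (k' * k') * (χ (c₁ * c₀⁻¹ * c₀⁻¹))⁻¹ = k * k := by
  have hk : k = χ c₀ * c₀⁻¹ * k'⁻¹ := eq_mul_inv_of_mul_eq hA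
  have hc : χ c₁ = k' * k' * (k' * k') * c₁ := by rw [hB, inv_mul_cancel_right]
  simp only [map_mul, map_inv]
  rw [hk, hc]
  apply Additive.ofMul.injective
  simp only [ofMul_mul, ofMul_inv]
  abel

/-! ### §2. Kummer cocycles of root systems of `1` are `χ`-coboundaries -/

/-- `1 ∈ ℚ̄_p^×` is fixed by `G_{ℚ_p}`. [folklore] -/
private theorem one_mem_fixedPoints_top :
    (1 : (PadicAlgCl p)ˣ) ∈ MulAction.fixedPoints (⊤ : Subgroup (GQp p)) (PadicAlgCl p)ˣ :=
  mem_fixedPoints_top_of_forall fun σ => smul_one σ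

/-- A product of two `G_{ℚ_p}`-fixed units is fixed. [folklore] -/
private theorem mul_mem_fixedPoints_top {a b : (PadicAlgCl p)ˣ}
    (ha : a ∈ MulAction.fixedPoints (⊤ : Subgroup (GQp p)) (PadicAlgCl p)ˣ)
    (hb : b ∈ MulAction.fixedPoints (⊤ : Subgroup (GQp p)) (PadicAlgCl p)ˣ) :
    a * b ∈ MulAction.fixedPoints (⊤ : Subgroup (GQp p)) (PadicAlgCl p)ˣ :=
  mem_fixedPoints_top_of_forall fun σ => by
    have h1 : σ • a = a := ha ⟨σ, Subgroup.mem_top σ⟩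
    have h2 : σ • b = b := hb ⟨σ, Subgroup.mem_top σ⟩
    rw [smul_mul', h1, h2]

/-- The Kummer cocycle of the TRIVIAL root system of `1` is trivial. [cite: NeukirchANT1999, Ch. IV §3] -/
theorem kummerZH_rootSystemOne (σ : GQp p) :
    kummerZH (RootSystem.one : RootSystem (1 : (PadicAlgCl p)ˣ)) (one_mem_fixedPoints_top p) σ = 1 := by
  rw [kummerZH_def, ← (cycEquiv p).map_one]
  congr 1
  refine Subtype.ext (funext fun n => ?_)
  rw [kummerCocycle_top_apply]
  change σ • (1 : (PadicAlgCl p)ˣ) / 1 = 1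
  rw [smul_one, div_one]

/-- **The Kummer cocycle of ANY root system of a unit equal to `1` is a `χ`-coboundary** `σ ↦ χ(σ)(c)/c` (the root
system is a compatible system of roots of unity `ζ`, `c := e(ζ)`, and `σ(ζ)/ζ ↦ χ(σ)c − c` in `Ẑ`).
[cite: NeukirchANT1999, Ch. IV §3] -/
theorem exists_coboundary_of_eq_one {u : (PadicAlgCl p)ˣ} (x : RootSystem u)
    (hu : u ∈ MulAction.fixedPoints (⊤ : Subgroup (GQp p)) (PadicAlgCl p)ˣ) (h1 : u = 1) :
    ∃ c : ZH, ∀ σ : GQp p, kummerZH x hu σ = chi p σ c * c⁻¹ := by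
  refine ⟨cycEquiv p (RootSystem.divCyclotome RootSystem.one (x.cast h1)), fun σ => ?_⟩
  rw [← kummerZH_cast x hu h1 (one_mem_fixedPoints_top p) σ,
    kummerZH_eq_mul_coboundary RootSystem.one (one_mem_fixedPoints_top p) (x.cast h1) σ,
    kummerZH_rootSystemOne, one_mul, div_eq_mul_inv]

/-! ### §3. The two coboundaries at `√−1` -/

/-- `√−1 · (√−1)⁻¹ = 1` for the units read in `ℚ̄_p^×`. [cite: MochizukiEtTh2009, Def 1.9 p.29] -/
theorem unitχ_sqrtNegOne_mul_inv (hp : p % 4 = 1) :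
    unitχ p (sqrtNegOneUnitχ p hp) * unitχ p (sqrtNegOneInvUnitχ p hp) = 1 :=
  Units.ext (by
    rw [Units.val_mul, Units.val_one]
    exact mul_inv_cancel₀ (sqrtNegOneχ_ne_zero p hp))

/-- `((√−1)⁻¹)⁴ = 1` (as `(a'·a')·(a'·a')`). [cite: MochizukiEtTh2009, Def 1.9 p.29] -/
theorem unitχ_sqrtNegOneInv_pow_four (hp : p % 4 = 1) :
    unitχ p (sqrtNegOneInvUnitχ p hp) * unitχ p (sqrtNegOneInvUnitχ p hp) *
      (unitχ p (sqrtNegOneInvUnitχ p hp) * unitχ p (sqrtNegOneInvUnitχ p hp)) = 1 :=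
  Units.ext (by
    have h2 : (sqrtNegOneχ p hp)⁻¹ * (sqrtNegOneχ p hp)⁻¹ = -1 := by rw [← sq]; exact sqrtNegOneχ_inv_sq p hp
    rw [Units.val_mul, Units.val_mul, Units.val_one]
    change (sqrtNegOneχ p hp)⁻¹ * (sqrtNegOneχ p hp)⁻¹ * ((sqrtNegOneχ p hp)⁻¹ * (sqrtNegOneχ p hp)⁻¹) = 1
    rw [h2]
    norm_num)

/-- **(A) `κ_{√−1} · κ_{(√−1)⁻¹}` is a `χ`-coboundary** (the product root system is a root system of `1`).
[cite: MochizukiEtTh2009, Def 1.9 p.29] -/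
theorem exists_coboundary_kappa_mul_kappaInv (hp : p % 4 = 1) :
    ∃ c₀ : ZH, ∀ σ : GQp p,
      kappaUnitχ p (sqrtNegOneUnitχ p hp) σ * kappaUnitχ p (sqrtNegOneInvUnitχ p hp) σ = chi p σ c₀ * c₀⁻¹ := by
  obtain ⟨c₀, hc₀⟩ := exists_coboundary_of_eq_one p
    ((RootSystem.ofRootableBy (unitχ p (sqrtNegOneUnitχ p hp))).mul
      (RootSystem.ofRootableBy (unitχ p (sqrtNegOneInvUnitχ p hp))))
    (mul_mem_fixedPoints_top p (unitχ_mem_fixedPoints p _) (unitχ_mem_fixedPoints p _))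
    (unitχ_sqrtNegOne_mul_inv p hp)
  refine ⟨c₀, fun σ => ?_⟩
  rw [← hc₀ σ, kappaUnitχ_def, kappaUnitχ_def,
    kummerZH_mulRoots _ _ (unitχ_mem_fixedPoints p _) (unitχ_mem_fixedPoints p _)]

/-- **(B) `κ_{(√−1)⁻¹}⁴` is a `χ`-coboundary** (the fourth-power root system is a root system of `1`).
[cite: MochizukiEtTh2009, Def 1.9 p.29] -/
theorem exists_coboundary_kappaInv_pow_four (hp : p % 4 = 1) :
    ∃ c₁ : ZH, ∀ σ : GQp p,
      kappaUnitχ p (sqrtNegOneInvUnitχ p hp) σ * kappaUnitχ p (sqrtNegOneInvUnitχ p hp) σ *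
        (kappaUnitχ p (sqrtNegOneInvUnitχ p hp) σ * kappaUnitχ p (sqrtNegOneInvUnitχ p hp) σ) =
      chi p σ c₁ * c₁⁻¹ := by
  set x' := RootSystem.ofRootableBy (unitχ p (sqrtNegOneInvUnitχ p hp)) with hx'
  have hf := unitχ_mem_fixedPoints p (sqrtNegOneInvUnitχ p hp)
  have hf2 := mul_mem_fixedPoints_top p hf hf
  obtain ⟨c₁, hc₁⟩ := exists_coboundary_of_eq_one p ((x'.mul x').mul (x'.mul x'))
    (mul_mem_fixedPoints_top p hf2 hf2) (unitχ_sqrtNegOneInv_pow_four p hp)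
  refine ⟨c₁, fun σ => ?_⟩
  rw [← hc₁ σ, kummerZH_mulRoots _ _ hf2 hf2, kummerZH_mulRoots _ _ hf hf, kappaUnitχ_def]

/-- **The deck exponent**: there is `t ∈ Ẑ` with `t · κ_{(√−1)⁻¹}(σ)² · (χ(σ)t)⁻¹ = κ_{√−1}(σ)²` for every `σ`.
[cite: MochizukiEtTh2009, Def 1.9 p.29] -/
theorem exists_deck_exponent (hp : p % 4 = 1) :
    ∃ t : ZH, ∀ σ : GQp p,
      t * (kappaUnitχ p (sqrtNegOneInvUnitχ p hp) σ * kappaUnitχ p (sqrtNegOneInvUnitχ p hp) σ) *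
          (chi p σ t)⁻¹ =
        kappaUnitχ p (sqrtNegOneUnitχ p hp) σ * kappaUnitχ p (sqrtNegOneUnitχ p hp) σ := by
  obtain ⟨c₀, hc₀⟩ := exists_coboundary_kappa_mul_kappaInv p hp
  obtain ⟨c₁, hc₁⟩ := exists_coboundary_kappaInv_pow_four p hp
  refine ⟨c₁ * c₀⁻¹ * c₀⁻¹, fun σ => ?_⟩
  letI : CommGroup ZH := { (inferInstance : Group ZH) with mul_comm := ZHatCompletion.mul_comm }
  exact deck_algebra (chi p σ).toMonoidHom (hc₀ σ) (hc₁ σ)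

/-! ### §4. The deck element `ε := b^t` and the deck relation `D_{τ⁻¹} = ε⁻¹ · D_τ · ε` -/

/-- Conjugating a twisted section by `b^t`, normal-factor component:
`(b^t · ⟨b^{f σ}, σ⟩ · b^{−t}).left = b^{t · f σ · (χ(σ) t)⁻¹}`. [cite: MochizukiEtTh2009, Def 1.9 p.29] -/
theorem inl_bPowGfp_conj_sectionχ_left (t : ZH) (f : GQp p → ZH)
    (hf : ∀ σ τ : GQp p, f (σ * τ) = f σ * chi p σ (f τ)) (σ : GQp p) :
    ((SemidirectProduct.inl (bPowGfp t) : PiTpχ p) * sectionχ p f hf σ * (SemidirectProduct.inl (bPowGfp t))⁻¹).left =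
      bPowGfp (t * f σ * (chi p σ t)⁻¹) := by
  simp only [SemidirectProduct.mul_left, SemidirectProduct.mul_right, SemidirectProduct.inv_left,
    SemidirectProduct.left_inl, SemidirectProduct.right_inl, sectionχ_left, sectionχ_right, map_one,
    MulAut.one_apply, one_mul, inv_one, map_inv, map_mul, actχ_apply, twistGfp_bPowGfp]

/-- … and Galois component: `(b^t · ⟨b^{f σ}, σ⟩ · b^{−t}).right = σ`. [cite: MochizukiEtTh2009, Def 1.9 p.29] -/
theorem inl_bPowGfp_conj_sectionχ_right (t : ZH) (f : GQp p → ZH)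
    (hf : ∀ σ τ : GQp p, f (σ * τ) = f σ * chi p σ (f τ)) (σ : GQp p) :
    ((SemidirectProduct.inl (bPowGfp t) : PiTpχ p) * sectionχ p f hf σ * (SemidirectProduct.inl (bPowGfp t))⁻¹).right =
      σ := by
  simp only [SemidirectProduct.mul_right, SemidirectProduct.inv_right, SemidirectProduct.right_inl, sectionχ_right,
    one_mul, inv_one, mul_one]

/-- **THE DECK ELEMENT EXISTS at `modelχ`** (`p ≡ 1 (mod 4)`): there is `ε ∈ Π^tp_X` of `toZ`-degree `0` with
`ε · s_{(√−1)⁻¹}(σ) · ε⁻¹ = s_{√−1}(σ)` for every `σ ∈ G_{ℚ_p}` — namely `ε := b^t` for the deck exponent `t`.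
[cite: MochizukiEtTh2009, Def 1.9 p.29] -/
theorem exists_deck_sectionOfUnitχ (hp : p % 4 = 1) :
    ∃ ε : PiTpχ p, (ThetaSetting.modelχ p).toZ ε = 1 ∧
      ∀ σ : GQp p, ε * sectionOfUnitχ p (sqrtNegOneInvUnitχ p hp) σ * ε⁻¹ =
        sectionOfUnitχ p (sqrtNegOneUnitχ p hp) σ := by
  obtain ⟨t, ht⟩ := exists_deck_exponent p hp
  refine ⟨SemidirectProduct.inl (bPowGfp t), ?_, fun σ => ?_⟩
  · rw [GfpTwistData.toZ_apply, SemidirectProduct.left_inl, gfpSnd_bPowGfp]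
  · rw [sectionOfUnitχ_def, sectionOfUnitχ_def]
    refine SemidirectProduct.ext ?_ ?_
    · rw [inl_bPowGfp_conj_sectionχ_left, sectionχ_left, Pi.mul_apply, Pi.mul_apply, ht σ]
    · rw [inl_bPowGfp_conj_sectionχ_right, sectionχ_right]

/-- From the section identity to the decomposition groups: `s'(G) = (s(G)).comap (conj ε)` when
`ε · s'(σ) · ε⁻¹ = s(σ)` for all `σ`. [folklore] -/
private theorem map_eq_comap_conj_of_conj_eq {s s' : GQp p →* PiTpχ p} {ε : PiTpχ p}
    (h : ∀ σ : GQp p, ε * s' σ * ε⁻¹ = s σ) (G : Subgroup (GQp p)) :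
    G.map s' = (G.map s).comap (MulAut.conj ε).toMonoidHom := by
  ext x
  rw [Subgroup.mem_comap, MulEquiv.coe_toMonoidHom, MulAut.conj_apply]
  constructor
  · rintro ⟨σ, hσ, rfl⟩
    exact ⟨σ, hσ, (h σ).symm⟩
  · rintro ⟨σ, hσ, hx⟩
    refine ⟨σ, hσ, ?_⟩
    rw [← h σ] at hx
    exact mul_left_cancel (mul_right_cancel hx)

/-- **THE DECK RELATION at `modelχ`**: `D_{τ⁻¹} = D_τ.comap (conj ε)` with `toZ ε = 1` — the data binder `hD` of the
K2 deck theorems (p430193 / p425484) INHABITED at the anchored points `τ^{±1} = anchoredPointχ (√−1)^{±1}`.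
[cite: MochizukiEtTh2009, Def 1.9 p.29] -/
theorem exists_deck_modelχ (hp : p % 4 = 1) :
    ∃ ε : PiTpχ p, (ThetaSetting.modelχ p).toZ ε = 1 ∧
      (tauInvχ p hp).Dpt = (tauχ p hp).Dpt.comap (MulAut.conj ε).toMonoidHom := by
  obtain ⟨ε, hε, h⟩ := exists_deck_sectionOfUnitχ p hp
  exact ⟨ε, hε, map_eq_comap_conj_of_conj_eq p h _⟩

/-- The same for the anchored standard datum over `(etaleThetaDataχSec p η).toKummerData` (any class `η̈`).
[cite: MochizukiEtTh2009, Def 1.9 p.29] -/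
theorem exists_deck_anchoredStandardDataχ (hp : p % 4 = 1)
    (η : (ThetaSetting.modelχ p).H1 (ThetaSetting.modelχ p).GtpYdd) :
    ∃ ε : (MuTwoSetting.modelχ p).PiTemp, (MuTwoSetting.modelχ p).toZ ε = 1 ∧
      (anchoredStandardDataχ p hp η).tauInv.Dpt =
        (anchoredStandardDataχ p hp η).tau.Dpt.comap (MulAut.conj ε).toMonoidHom :=
  exists_deck_modelχ p hp

/-- **… and the deck element is NOT in `Π^tp_Ÿ`** (this lineage's `AnchoredStandardData.deck_not_mem_GtpYdd`, p430193:
anchoring + Prop. 1.5 (ii) force `ε ∉ Π^tp_Ÿ`) — so at the model `ε = b^t` is a genuine representative of the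
non-trivial element of `Gal(Ÿ/Y) = Π^tp_Y/Π^tp_Ÿ`, as print's `μ₂`-deck transformation. [cite: MochizukiEtTh2009, Def 1.9 p.29] -/
theorem exists_deck_not_mem_GtpYdd_modelχ (hp : p % 4 = 1)
    (η : (ThetaSetting.modelχ p).H1 (ThetaSetting.modelχ p).GtpYdd) :
    ∃ ε : (MuTwoSetting.modelχ p).PiTemp, (MuTwoSetting.modelχ p).toZ ε = 1 ∧ ε ∉ (MuTwoSetting.modelχ p).GtpYdd ∧
      (anchoredStandardDataχ p hp η).tauInv.Dpt =
        (anchoredStandardDataχ p hp η).tau.Dpt.comap (MulAut.conj ε).toMonoidHom := by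
  obtain ⟨ε, hε, hD⟩ := exists_deck_anchoredStandardDataχ p hp η
  exact ⟨ε, hε, (anchoredStandardDataχ p hp η).deck_not_mem_GtpYdd (MuTwoSetting.modelχ_compat p)
    (prop15ii_etaleThetaDataχSec p η) hD, hD⟩

/-! ### §5. Thm. 1.10 (i)(ii) at `modelχ` by the DECK ROUTE with every binder discharged -/

/-- **Thm. 1.10 (i) and (ii) at the χ-model via the deck route p430193** (`γ = id`, `p ≡ 1 (mod 4)`, any class `η̈`):
the binders of `thm110i/ii_of_decompTransport_of_deck` are ALL theorems here — `Thm110DeltaInduced H δ`,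
`Thm110DeltaCompat δ`, the typed row r5 `Thm110DecompTransport H A A` (`modelχ_thm110i_inputs`), `Prop15ii`
(abc-iut-L6-d5) and the deck relations (`exists_deck_anchoredStandardDataχ`) — and the route concludes
`Thm110i H A A ∧ Thm110ii H A A`. [cite: MochizukiEtTh2009, Thm 1.10 (ii) p.30] -/
theorem modelχ_thm110i_and_ii_of_deck (hp : p % 4 = 1)
    (η : (ThetaSetting.modelχ p).H1 (ThetaSetting.modelχ p).GtpYdd) :
    ∃ (H : Thm110Hypothesis (Mα := MuTwoSetting.modelχ p) (Mβ := MuTwoSetting.modelχ p) (epsZχ p) (epsZχ p)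
        (MuTwoSetting.modelχ_compat p) (MuTwoSetting.modelχ_compat p)
        (etaleThetaDataχM p η) (etaleThetaDataχM p η) (ContinuousMulEquiv.refl _))
      (δ : (↥(MuTwoSetting.modelχ p).Kdd)ˣ ≃* (↥(MuTwoSetting.modelχ p).Kdd)ˣ)
      (ε : (MuTwoSetting.modelχ p).PiTemp),
      Thm110DeltaInduced H δ ∧ Thm110DeltaCompat (Mα := MuTwoSetting.modelχ p) (Mβ := MuTwoSetting.modelχ p) δ ∧
      Thm110DecompTransport H (anchoredStandardDataχ p hp η).toStandardData
        (anchoredStandardDataχ p hp η).toStandardData ∧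
      (MuTwoSetting.modelχ p).toZ ε = 1 ∧
      (anchoredStandardDataχ p hp η).tauInv.Dpt =
        (anchoredStandardDataχ p hp η).tau.Dpt.comap (MulAut.conj ε).toMonoidHom ∧
      Thm110i H (anchoredStandardDataχ p hp η).toStandardData (anchoredStandardDataχ p hp η).toStandardData ∧
      Thm110ii H (anchoredStandardDataχ p hp η).toStandardData (anchoredStandardDataχ p hp η).toStandardData := by
  obtain ⟨H, δ, hδ, hcompat, σ, σ', hσ, hσ', hmatch⟩ := modelχ_thm110i_inputs p hp η
  obtain ⟨ε, hε, hD⟩ := exists_deck_anchoredStandardDataχ p hp η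
  have hτ : Thm110DecompTransport H (anchoredStandardDataχ p hp η).toStandardData
      (anchoredStandardDataχ p hp η).toStandardData := by
    rcases hmatch with ⟨h1, -⟩ | ⟨h1, -⟩
    · exact ⟨σ, hσ, Or.inl h1⟩
    · exact ⟨σ, hσ, Or.inr h1⟩
  exact ⟨H, δ, ε, hδ, hcompat, hτ, hε, hD,
    thm110i_of_decompTransport_of_deck H _ _ (prop15ii_etaleThetaDataχSec p η) (prop15ii_etaleThetaDataχSec p η)
      δ hδ hcompat hτ hε hD hε hD,
    thm110ii_of_decompTransport_of_deck H _ _ (prop15ii_etaleThetaDataχSec p η) (prop15ii_etaleThetaDataχSec p η)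
      δ hδ hτ hε hD hε hD⟩

end Literature.AnabelianGeometry.EtaleTheta.SettingModel

end
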